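import Summits.AtomisticToContinuum.BoseEinsteinCondensation.Theses.BECPalmDirectCorrelation

/-!
# Route `BECPalmDirectCorrelation` — the glue `PalmSplitGlue` (stmt-AtomisticToContinuum-12227)

For each repulsive finite-range `v`: the `NonlinearPalmBound` body for `v` (for every slack `δ`
some `δ`-near-minimiser has `F ≤ 1 + G + C`) and the `GaussianPalmBound` body for `v` (for some
slack `δ₀` every `δ₀`-near-minimiser has `G ≤ C'`) give the liminf χ² bound for `v` (for every
slack `δ` some `δ`-near-minimiser has `F ≤ C''`), which is the hypothesis of
`PalmChiSqCondensation`.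

Proof (pure bookkeeping): `ρ₀'' = min ρ₀ ρ₀'`, `C'' = 1 + max C' 0 + max C 0`, intersect the two
eventual-`n` sets; given `δ` take the nonlinear witness at slack `min δ δ₀`: it is a
`δ`-near-minimiser and a `δ₀`-near-minimiser (so `G ≤ C'`), hence
`F ≤ 1 + G + C ≤ 1 + C' + C ≤ C''` in `ℝ≥0∞`.
-/

namespace Summit.AtomisticToContinuum.BoseEinsteinCondensation.Theorems

/-- The only arithmetic of the glue, in `ℝ≥0∞`: from `F ≤ 1 + G + ofReal C` and `G ≤ ofReal C'`
conclude `F ≤ ofReal (1 + max C' 0 + max C 0)`. [folklore] -/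
theorem palmSplitGlue_arith {F G : ENNReal} {C C' : ℝ} (hF : F ≤ 1 + G + ENNReal.ofReal C)
    (hG : G ≤ ENNReal.ofReal C') : F ≤ ENNReal.ofReal (1 + max C' 0 + max C 0) := by
  have h0 : (0 : ℝ) ≤ max C' 0 := le_max_right _ _
  have h1 : (0 : ℝ) ≤ max C 0 := le_max_right _ _
  rw [ENNReal.ofReal_add (by positivity) h1, ENNReal.ofReal_add zero_le_one h0, ENNReal.ofReal_one]
  calc F ≤ 1 + G + ENNReal.ofReal C := hF
    _ ≤ 1 + ENNReal.ofReal (max C' 0) + ENNReal.ofReal (max C 0) := by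
      gcongr
      · exact hG.trans (ENNReal.ofReal_le_ofReal (le_max_left _ _))
      · exact le_max_left _ _

/-- Settles `stmt-AtomisticToContinuum-12227` (exact signature): the support glue `PalmSplitGlue`
of route `BECPalmDirectCorrelation` — the `NonlinearPalmBound` body and the `GaussianPalmBound`
body for a repulsive finite-range `v` imply the liminf χ² bound for `v`. Proof: `ρ₀'' = min ρ₀ ρ₀'`,
`C'' = 1 + max C' 0 + max C 0`, intersection of the two eventual-`n` sets, nonlinear witness at
slack `min δ δ₀`, then `palmSplitGlue_arith`. [folklore] -/
theorem palmSplitGlue_proof :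
    Summit.AtomisticToContinuum.BoseEinsteinCondensation.Theses.BECPalmDirectCorrelation.PalmSplitGlue := by
  unfold Theses.BECPalmDirectCorrelation.PalmSplitGlue
  intro v _hv hNL hG
  obtain ⟨ρ₀, hρ₀, hNL⟩ := hNL
  obtain ⟨ρ₀', hρ₀', hG⟩ := hG
  refine ⟨min ρ₀ ρ₀', lt_min hρ₀ hρ₀', fun ρ hρ hρlt => ?_⟩
  obtain ⟨C, hC⟩ := hNL ρ hρ (lt_of_lt_of_le hρlt (min_le_left _ _))
  obtain ⟨C', hC'⟩ := hG ρ hρ (lt_of_lt_of_le hρlt (min_le_right _ _))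
  refine ⟨1 + max C' 0 + max C 0, ?_⟩
  filter_upwards [hC, hC'] with n hn hn'
  dsimp only at hn hn' ⊢
  intro δ hδ
  obtain ⟨δ₀, hδ₀, hall⟩ := hn'
  obtain ⟨Ψ, hΨE, hΨF⟩ := hn (min δ δ₀) (lt_min hδ hδ₀)
  refine ⟨Ψ, hΨE.trans (add_le_add le_rfl (min_le_left _ _)), ?_⟩
  exact palmSplitGlue_arith hΨF (hall Ψ (hΨE.trans (add_le_add le_rfl (min_le_right _ _))))

end Summit.AtomisticToContinuum.BoseEinsteinCondensation.Theorems
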